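import Summits.CriticalPhenomena.CardyFormulaZ2.Theses.CardyBondTriangular
import Literature.Probability.Percolation.TriApproxDomain
import Summits.CriticalPhenomena.CardyFormulaZ2.Theorems.CardyBondTriangularBondTriangularCardyArmOfUpperBounds
import Summits.CriticalPhenomena.CardyFormulaZ2.Theorems.CardyBondTriangularBondTriangularCardySepDiffArm
import Summits.CriticalPhenomena.CardyFormulaZ2.Theorems.CardyBondTriangularSwitchingReductionFormats
import Summits.CriticalPhenomena.CardyFormulaZ2.Theorems.CardyBondTriangularBondTriangularBoxCrossingReduction
import HarnessLib

/-!
# Route CardyBondTriangular · crux `BondTriangularCardy` (stmt-CriticalPhenomena-4664), line `birth`: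
# Stub 2 `stub_threeArmSmall` — (12) on compacta for critical bond-`𝕋`, from the box-crossing property

Crux `Summit.CriticalPhenomena.CardyFormulaZ2.Theses.CardyBondTriangular.BondTriangularCardy`, line
`birth`, stub `stub_threeArmSmall : Sig.stub_threeArmSmall` (the registered signature, whose text —
`Sig.threeArmSmall`, `Sig.stub_threeArmSmall` — is repeated verbatim below from the line lead's
`Sig` file): Bollobás–Riordan's (12) (*Percolation* (2006), Ch. 7, p. 181: "`hⁱ_δ(w, z) → 0`
uniformly on compacta") for the Chayes–Lei separating probabilities of critical bond percolation
on the triangular lattice, `clSepDiffProb (G δ).dropLast triBondCritical i w (oppFace w j) ≤ ε_K(δ) → 0`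
at the faces `w` with centre in a compact `K ⊆ Ω`, FROM the box-crossing property of critical
bond-`𝕋` (route item `BondTriangularBoxCrossing`, by name).

Proof (Bollobás–Riordan's Claim 10 p. 177 and Lemma 4 p. 166, for bond-`𝕋`):
* combinatorics and dictionary (`bondTri_sepDiff_openArm`, file `…BondTriangularCardySepDiffArm`):
  on `Eⁱ(z_j) ∖ Eⁱ(w)` the separating yellow path must use the bond dual to the edge `w z_j`, so
  under the packaging `clOfBond` there is an open path of `𝕋` from within distance `2` of the
  centre of `w` to within distance `1` of the arc `A_{i+1}`;
* geometry (`eventually_le_infDist_arcPts_of_isDiscreteApprox`): eventually the three discrete arcs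
  are `≥ a_K > 0` away from `K`, so at mesh `δ` the arm reaches sup-norm distance
  `≥ (a_K/δ - 1)/2` in lattice units;
* the one-arm bound with a rate (`bondTriOneArmBound_of_hasBoxCrossingProperty`, from
  `bondTriArm_le_of_upperBounds`, file `…BondTriangularCardyArmOfUpperBounds`: Grimmett–Manolescu
  2013 Prop. 23 (a), `P(Λ_2(w) ↔ ∂Λ_N(w)) ≤ g(N) → 0`, `g(N) = (1 - c⁴)^{⌊log₅ (N / 3R₀)⌋ + 1}`,
  uniformly in the centre `w`), fed by the upper bounds at aspect ratio `1/4` of the box-crossing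
  property in the drawing `triEmbed` (the route item read through
  `bondTriangularBoxCrossing_iff_GM2013` at scale `s = 1`);
* the law identity `clHexPercolation triBondCritical = (bondPercolation 𝕋 p_c).map clOfBond`
  (`map_clOfBond_bondPercolation`), and `ε_K(δ) := g((a_K/δ - 1)/2)`.

References: B. Bollobás, O. Riordan, *Percolation*, CUP 2006, Ch. 7, (12) p. 181, Claim 10
p. 177, Lemma 4 p. 166 [BollobasRiordan2006]; G. R. Grimmett, I. Manolescu, Ann. Probab. 41 (2013)
§1.3 Thm 3 (b), §4.1 Prop. 23 (a) [GrimmettManolescuAOP2013]; L. Chayes, H. K. Lei, Rev. Math.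
Phys. 19 (2007) §2.1 [ChayesLei2007].
-/

noncomputable section

namespace Summit.CriticalPhenomena.CardyFormulaZ2.Theorems.BondTriangularCardyLine

open Set Filter Topology Metric

/-! ### The registered signature (verbatim from the line lead's `Sig` file) -/

/-- Unconditional core of Stub 2 (`Sig.threeArmSmall`; the registered signature `Sig.stub_threeArmSmall` is this from RSW): (12) on compacta for critical bond-𝕋 (Bollobás–Riordan 2006, (12) p. 181 via Claim 10
and Lemma 4): for any discrete approximation `G` of `R`, the three-arm differences
`hⁱ_δ(w, z_j) = P(Eⁱ_δ(z_j) ∖ Eⁱ_δ(w))` of the Chayes–Lei separating probabilities of `(G δ).dropLast`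
are `≤ ε_K(δ) → 0` at the faces with centre in a compact `K ⊆ Ω`, eventually. Why plausibly true: a
yellow path separating `z_j` but not `w` uses the bond dual to the edge `w z_j`, so it contains a
primal arm from `B(w, 2δ)` to a discrete arc, at distance `≥ a_K > 0` eventually
(`eventually_le_infDist_arcPts_of_isDiscreteApprox`); one-arm RSW decay for bond-𝕋 at
`2 sin(π/18)` (route support `BondTriangularBoxCrossing`, fact `gm_boxCrossing`). (ref: BollobasRiordan2006, Ch. 7 (12) p. 181, Claim 10 p. 177, Lemma 4 p. 166) -/
def Sig.threeArmSmall : Prop :=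
    ∀ (R : Literature.Probability.RandomPlanarGeometry.ConformalRectangle) (G : ℝ → Literature.Probability.Percolation.TriMarkedDomain 4), Literature.Probability.Percolation.IsDiscreteApprox R G →
      ∀ K : Set ℂ, IsCompact K → K ⊆ R.carrier → ∃ ε : ℝ → ℝ, Tendsto ε (𝓝[>] 0) (𝓝 0) ∧
        ∀ᶠ δ : ℝ in 𝓝[>] 0, ∀ w : Literature.Probability.LatticeModels.HexVertex, (δ : ℂ) * Literature.Probability.LatticeModels.hexCenter w ∈ K →
          ∀ i j : Fin 3, (G δ).dropLast.clSepDiffProb Literature.Probability.Percolation.ChayesLeiHexPercolation.triBondCritical i w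
            (Literature.Probability.Percolation.oppFace w j) ≤ ε δ

/-- Signature of `stub_threeArmSmall` (reshape v2): (12) on compacta for critical bond-𝕋, `Sig.threeArmSmall`, from the
box-crossing property of critical bond-𝕋 (route item `BondTriangularBoxCrossing`, stmt-CriticalPhenomena-7023, BY NAME;
GM2013 in print, unproved in the tree). (ref: BollobasRiordan2006, Ch. 7 (12) p. 181; GrimmettManolescuAOP2013, §1.3 main theorem (b)) -/
def Sig.stub_threeArmSmall : Prop :=
    Summit.CriticalPhenomena.CardyFormulaZ2.Theses.CardyBondTriangular.BondTriangularBoxCrossing → Sig.threeArmSmall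

/-! ### The one-arm bound with a rate, and the proof -/

open MeasureTheory Literature.Probability.Percolation Literature.Probability.LatticeModels
open Literature.Probability.Percolation.IsoradialCriticality
open Summit.CriticalPhenomena.CardyFormulaZ2.Theorems

/-- **One-arm decay for bond percolation on `𝕋` from the box-crossing property, with a rate**
(Bollobás–Riordan's Lemma 4 p. 166 for bond-`𝕋`; Grimmett–Manolescu 2013 Prop. 23 (a)): if
`bondPercolation triGraph p` has the box-crossing property in the drawing `triEmbed`, there is
`g → 0` at `+∞` such that, for every centre `w ∈ ℂ` and every `N`, an open path of `𝕋` from the box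
`Λ_2(w)` to sup-norm distance `≥ N` from `w` has probability `≤ g(N)`. Here
`g(N) = (1 - c⁴)^{K(N)+1}`, `K(N) = ⌊log₅(⌊N⌋ / 3R₀)⌋`, for `N ≥ 3R₀` (`R₀ = n₀ + 3`, `c, n₀` the
box-crossing constants at aspect ratio `1/4`), and `g(N) = 1` below (`bondTriArm_le_of_upperBounds`).
[cite: GrimmettManolescuAOP2013, §4.1 Proposition 23 (a) (arXiv:1105.5535 numbering)] -/
theorem bondTriOneArmBound_of_hasBoxCrossingProperty (p : unitInterval)
    (h : HasBoxCrossingProperty (bondPercolation triGraph p) triEmbed) :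
    ∃ g : ℝ → ℝ, Tendsto g atTop (𝓝 0) ∧ ∀ (w : ℂ) (N : ℝ),
      (bondPercolation triGraph p).real {ω | ∃ u v : Site 2, (openGraph ω).Reachable u v ∧
        (triEmbed u - w).boxNorm ≤ 2 ∧ N ≤ (triEmbed v - w).boxNorm} ≤ g N := by
  obtain ⟨c, hc, n₀, hbd⟩ := h (1 / 4) (by norm_num)
  have hup : ∀ n : ℕ, n₀ ≤ n → ∀ w : ℂ,
      (bondPercolation triGraph p).real
          (embRectCrossing (fun v => triEmbed v - w) ((1 / 4 : ℝ) * n) n) ≤ 1 - c ∧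
        (bondPercolation triGraph p).real
          (embTBCrossing (fun v => triEmbed v - w) n ((1 / 4 : ℝ) * n)) ≤ 1 - c :=
    fun n hn w => ⟨(hbd n hn w).1.2, (hbd n hn w).2.2⟩
  have hc1 : c ≤ 1 := (hbd n₀ le_rfl 0).1.1.trans measureReal_le_one
  set θ : ℝ := 1 - c ^ 4 with hθ
  have hθ0 : 0 ≤ θ := by have := pow_le_one₀ (n := 4) hc.le hc1; rw [hθ]; linarith
  have hθ1 : θ < 1 := by have := pow_pos hc 4; rw [hθ]; linarith
  set R₀ : ℕ := n₀ + 3 with hR₀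
  have hR₀pos : 0 < 3 * R₀ := by omega
  set Kf : ℝ → ℕ := fun N => Nat.log 5 (⌊N⌋₊ / (3 * R₀)) with hKf
  refine ⟨fun N => if (3 * R₀ : ℝ) ≤ N then θ ^ (Kf N + 1) else 1, ?_, fun w N => ?_⟩
  · -- `K(N) → ∞`, so `g → 0`
    have hK : Tendsto Kf atTop atTop := by
      refine tendsto_atTop_atTop.2 fun M => ⟨((3 * R₀ * 5 ^ M : ℕ) : ℝ), fun N hN => ?_⟩
      have h1 : 3 * R₀ * 5 ^ M ≤ ⌊N⌋₊ := Nat.le_floor hN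
      have h2 : 5 ^ M ≤ ⌊N⌋₊ / (3 * R₀) :=
        (Nat.le_div_iff_mul_le hR₀pos).2 (by rwa [mul_comm] at h1)
      exact Nat.le_log_of_pow_le (by norm_num) h2
    have hpow : Tendsto (fun N => θ ^ (Kf N + 1)) atTop (𝓝 0) :=
      (tendsto_pow_atTop_nhds_zero_of_lt_one hθ0 hθ1).comp ((tendsto_add_atTop_nat 1).comp hK)
    refine hpow.congr' ?_
    filter_upwards [eventually_ge_atTop (3 * R₀ : ℝ)] with N hN
    exact (if_pos hN).symm
  · dsimp only
    by_cases hN : (3 * R₀ : ℝ) ≤ N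
    · rw [if_pos hN]
      have hN' : ((3 * R₀ : ℕ) : ℝ) ≤ N := by push_cast; exact hN
      have hfl : 3 * R₀ ≤ ⌊N⌋₊ := Nat.le_floor hN'
      have hm : ⌊N⌋₊ / (3 * R₀) ≠ 0 := (Nat.div_pos hfl hR₀pos).ne'
      have h5 : 5 ^ Kf N ≤ ⌊N⌋₊ / (3 * R₀) := Nat.pow_log_le_self 5 hm
      have h6 : 3 * R₀ * 5 ^ Kf N ≤ ⌊N⌋₊ :=
        calc 3 * R₀ * 5 ^ Kf N ≤ 3 * R₀ * (⌊N⌋₊ / (3 * R₀)) := Nat.mul_le_mul_left _ h5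
          _ = ⌊N⌋₊ / (3 * R₀) * (3 * R₀) := by ring
          _ ≤ ⌊N⌋₊ := Nat.div_mul_le_self _ _
      have hN0 : 0 ≤ N := le_trans (by positivity) hN
      have h7 : (3 * ((n₀ : ℝ) + 3) * 5 ^ Kf N : ℝ) ≤ N := by
        have h6' : ((3 * R₀ * 5 ^ Kf N : ℕ) : ℝ) ≤ ⌊N⌋₊ := by exact_mod_cast h6
        have hfloor : (⌊N⌋₊ : ℝ) ≤ N := Nat.floor_le hN0
        push_cast [hR₀] at h6'
        linarith
      refine le_trans (measureReal_mono fun ω hω => ?_)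
        (bondTriArm_le_of_upperBounds p c hc n₀ hup w (Kf N))
      obtain ⟨u, v, huv, hu, hv⟩ := hω
      refine ⟨u, v, huv, hu.trans ?_, h7.trans hv⟩
      have : (0 : ℝ) ≤ n₀ := Nat.cast_nonneg _
      linarith
    · rw [if_neg hN]; exact measureReal_le_one

/-- The Chayes–Lei packaging `clOfBond` of a bond configuration is measurable (each hexagon state
is a function of three bonds). [cite: ChayesLei2007, §2.1 p. 4] -/
theorem measurable_clOfBond : Measurable (clOfBond : BondConfig (Site 2) → CLHexConfig) := by
  classical
  refine measurable_pi_lambda _ fun x => ?_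
  exact (measurable_of_countable fun b : Fin 3 → Prop => stateOfBonds fun j => decide (b j)).comp
    (measurable_pi_lambda _ fun j => measurable_set_mem _)

/-- **(12) on compacta for critical bond-`𝕋` from a one-arm bound with a rate** (the reduction of
Stub 2 to Bollobás–Riordan's Lemma 4 for bond-`𝕋`): if an open path of `𝕋` from `Λ_2(w)` to
sup-norm distance `N` has `P_{p_c}`-probability `≤ g(N)`, `g → 0`, uniformly in the centre `w`,
then `Sig.threeArmSmall` holds with `ε_K(δ) = g((a_K/δ - 1)/2)`, `a_K` the eventual distance from
`K` to the three discrete arcs (`eventually_le_infDist_arcPts_of_isDiscreteApprox`): on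
`Eⁱ(z_j) ∖ Eⁱ(w)` there is an open arm from within `2` of the centre of `w` to within `1` of
`A_{i+1}` (`bondTri_sepDiff_openArm`), i.e. to sup-norm distance `≥ (a_K/δ - 1)/2`, and
`clHexPercolation triBondCritical = (bondPercolation 𝕋 p_c).map clOfBond`
(`map_clOfBond_bondPercolation`). [cite: BollobasRiordan2006, Ch. 7 (12) p. 181, Claim 10 p. 177, Lemma 4 p. 166] -/
theorem threeArmSmall_of_oneArmBound
    (harm : ∃ g : ℝ → ℝ, Tendsto g atTop (𝓝 0) ∧ ∀ (w : ℂ) (N : ℝ),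
      (bondPercolation triGraph (criticalWeightI (Real.pi / 6))).real
          {ω | ∃ u v : Site 2, (openGraph ω).Reachable u v ∧
            (triEmbed u - w).boxNorm ≤ 2 ∧ N ≤ (triEmbed v - w).boxNorm} ≤ g N) :
    Sig.threeArmSmall := by
  obtain ⟨g, hg, hbound⟩ := harm
  intro R G hG K hK hKΩ
  obtain ⟨a, ha, harcs⟩ := eventually_le_infDist_arcPts_of_isDiscreteApprox hG hK hKΩ
  refine ⟨fun δ => g ((a / δ - 1) / 2), ?_, ?_⟩
  · -- `(a/δ - 1)/2 → +∞` as `δ → 0⁺`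
    refine hg.comp ?_
    have h1 : Tendsto (fun δ : ℝ => a * δ⁻¹) (𝓝[>] 0) atTop :=
      tendsto_inv_nhdsGT_zero.const_mul_atTop ha
    have h2 : Tendsto (fun δ : ℝ => (a * δ⁻¹ + -1) / 2) (𝓝[>] 0) atTop :=
      (tendsto_atTop_add_const_right _ _ h1).atTop_div_const (by norm_num)
    exact h2.congr fun δ => by ring
  · have hfaces := eventually_mem_faces_of_isDiscreteApprox hG hK hKΩ
    filter_upwards [hfaces, harcs, self_mem_nhdsWithin] with δ hfaces harcs hδ w hwK i j
    have hδ : 0 < δ := hδ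
    have hw : hexFaceVertices w ⊆ (G δ).dropLast.verts := ((G δ).mem_faces).1 (hfaces w hwK)
    have hfar : a ≤ infDist ((δ : ℂ) * hexCenter w) ((G δ).dropLast.arcPts δ (i + 1)) :=
      harcs _ hwK (i + 1)
    -- the law of the packaged configuration
    have hlaw : clHexPercolation ChayesLeiHexPercolation.triBondCritical =
        (bondPercolation triGraph (criticalWeightI (Real.pi / 6))).map clOfBond :=
      (map_clOfBond_bondPercolation _).symm
    unfold TriMarkedDomain.clSepDiffProb
    rw [hlaw, map_measureReal_apply measurable_clOfBond
      (((G δ).dropLast.measurableSet_clSepEvent i _).diff ((G δ).dropLast.measurableSet_clSepEvent i w))]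
    refine le_trans (measureReal_mono fun ω hω => ?_) (hbound (hexCenter w) ((a / δ - 1) / 2))
    obtain ⟨u, v, huv, hu, t, ht, hv⟩ := bondTri_sepDiff_openArm (G δ).dropLast w hw i j ω hω
    refine ⟨u, v, huv, (boxNorm_le_norm _).trans hu, ?_⟩
    -- the far end: `t ∈ A_{i+1}` is `≥ a/δ` from the centre of `w`, and `v` is within `1` of `t`
    have ht' : triMeshPoint δ t ∈ (G δ).dropLast.arcPts δ (i + 1) := Set.mem_image_of_mem _ ht
    have h1 : a ≤ δ * ‖triEmbed t - hexCenter w‖ := by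
      refine hfar.trans ((infDist_le_dist_of_mem ht').trans_eq ?_)
      rw [dist_eq_norm, triMeshPoint, ← mul_sub, norm_mul, Complex.norm_real, Real.norm_eq_abs,
        abs_of_pos hδ, norm_sub_rev]
    have h2 : a / δ ≤ ‖triEmbed t - hexCenter w‖ := by
      rw [div_le_iff₀ hδ, mul_comm]; exact h1
    have h3 : ‖triEmbed t - hexCenter w‖ ≤ ‖triEmbed t - triEmbed v‖ + ‖triEmbed v - hexCenter w‖ :=
      norm_sub_le_norm_sub_add_norm_sub _ _ _
    have h4 : ‖triEmbed t - triEmbed v‖ ≤ 1 := by rw [norm_sub_rev]; exact hv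
    have h5 : ‖triEmbed v - hexCenter w‖ ≤ 2 * (triEmbed v - hexCenter w).boxNorm :=
      norm_le_two_mul_boxNorm _
    linarith

/-- **Stub 2 of line `birth`** (`stub_threeArmSmall : Sig.stub_threeArmSmall`): (12) on compacta for
the Chayes–Lei separating probabilities of critical bond-`𝕋`, from the box-crossing property of
critical bond-`𝕋` (route item `BondTriangularBoxCrossing`, by name): the item is the named fact
`GrimmettManolescuAOP2013_triangular_boxCrossing` (`bondTriangularBoxCrossing_iff_GM2013`), whose
instance at scale `s = 1` is the box-crossing property in the drawing `triEmbed`; then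
`bondTriOneArmBound_of_hasBoxCrossingProperty` and `threeArmSmall_of_oneArmBound`.
[cite: BollobasRiordan2006, Ch. 7 (12) p. 181] -/
theorem stub_threeArmSmall : Sig.stub_threeArmSmall := by
  intro h
  have h1 := (bondTriangularBoxCrossing_iff_GM2013.1 h) 1 one_pos (by norm_num)
  simp only [Complex.ofReal_one, one_mul] at h1
  exact threeArmSmall_of_oneArmBound (bondTriOneArmBound_of_hasBoxCrossingProperty _ h1)

end Summit.CriticalPhenomena.CardyFormulaZ2.Theorems.BondTriangularCardyLine

end
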